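import Summits.CriticalPhenomena.Ising3DConformalLimit.Theorems.HyperoctahedralRPExistsScaleCovariantLimitFoldedCurrentTransverseDefs
import Summits.CriticalPhenomena.Ising3DConformalLimit.Theorems.HyperoctahedralRPExistsScaleCovariantLimitFoldedCurrentIdentity
import Summits.CriticalPhenomena.Ising3DConformalLimit.Theorems.HyperoctahedralRPExistsScaleCovariantLimitFunnelDoublingIffAxisRate
import Literature.Probability.LatticeModels.BoxTwoPointTransfer
import Literature.Probability.LatticeModels.CriticalTwoPointBounds
import Literature.Probability.LatticeModels.MessagerMiracleSole
import Literature.Probability.LatticeModels.CriticalTwoPointLower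
import HarnessLib

/-!
# Line `folded-current-repulsion`: the folded identity for every coordinate mirror, and the TRANSVERSE twin of the engine

Lead `prover-line-stmt-CriticalPhenomena-1981-c11-0` (crux `ExistsScaleCovariantLimit`, stmt-CriticalPhenomena-1981). Card cut (4):
"with the mirror `{x₁ = j}` the same identity gives `G(ke₀ + 2je₁)/g(k) = P^{0,ke₀}[ke₀ ⟷ {x₁ = j} in n + 𝓡_j n]`, so doubling ⟸ the folded
cluster of the source reaches transverse distance `k` with probability `≥ κ` (MMS: `T(k,k) ≤ g(2k)/g(k)`)".

* `foldedIdentityAt i` — Aizenman's Thm 14.2 on the box for the mirror `xᵢ ↦ −xᵢ` (the abstract generating-function identity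
  `currentZ_singleton_symmDiff_reflect_eq` of the F1 file, p138063, at the fold datum `isFoldable_boxAt i L`);
* `tendsto_foldHitProbAt_transverse` — the transverse dictionary: with `x = −je₁`, `y = ke₀ − je₁` (both strictly left of `{x₁ = 0}`;
  translate the card's picture by `−je₁`), `P^{xy}_{Λ_L,β_c}[y ⟷ {x₁ = 0} folded] → G(ke₀ + 2je₁)/g(k)`;
* `criticalTwoPoint_transverse_le` — Messager–Miracle-Solé `k` times along `e₀` and the lattice symmetry `e₁ ↔ e₀`:
  `G(me₀ + 2ke₁) ≤ g(2k)`;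
* `twoPointDoubling_of_transverse` (registered sub-goal) — a uniform LOWER bound `κ` on the transverse reach probability at `j = k`
  implies item 6150 `TwoPointDoubling`.

References: M. Aizenman, Math. Phys. Anal. Geom. 28 (2025) 32, Thm 14.2; A. Messager, S. Miracle-Solé, J. Stat. Phys. 17 (1977);
S. Friedli, Y. Velenik, *Statistical Mechanics of Lattice Systems* (CUP 2017), Exercise 3.14.
-/

noncomputable section

open Filter Topology Finset
open scoped BigOperators symmDiff ENNReal
open Literature.Probability.LatticeModels
open Summit.CriticalPhenomena.Ising3DConformalLimit.Theses
open Classical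

namespace Summit.CriticalPhenomena.Ising3DConformalLimit.Cruxes.ExistsScaleCovariantLimit.FoldedCurrentRepulsion

/-! ## The identity for every coordinate mirror -/

/-- The core in current form for the mirror `θᵢ`: `Z_{Λ_L}({x} ∆ {θᵢ y}) = foldHitZAt i L β x y` for `x, y` strictly left of `{xᵢ = 0}`.
[cite: Aizenman2025GeometricIII, Thm 14.2 and Lemma 14.3] -/
theorem currentZ_mirrorAt_eq_foldHitZAt (i : Fin 3) (L : ℕ) {β : ℝ} (hβ : 0 ≤ β) {x y : Site 3} (hx : x ∈ leftHalfAt i L)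
    (hy : y ∈ leftHalfAt i L) :
    currentZ (zdGraph 3) (box 3 L) β (edgesIn (zdGraph 3) (box 3 L)) ({x} ∆ {mirrorAt i y}) = foldHitZAt i L β x y := by
  rw [currentZ_singleton_symmDiff_reflect_eq (isFoldable_boxAt i L) hβ hx hy]
  rfl

/-- **Aizenman's folded identity on the box for the mirror `xᵢ ↦ −xᵢ`** (free b.c.): for `β ≥ 0` and `x, y ∈ Λ_L` with `xᵢ, yᵢ < 0`,
`⟨σ_x σ_{θᵢ y}⟩^∅_{Λ_L,β} = ⟨σ_x σ_y⟩^∅_{Λ_L,β} · P^{xy}_{Λ_L,β}[y ⟷ {xᵢ = 0} in n + θᵢ(n)]`.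
[cite: Aizenman2025GeometricIII, Thm 14.2 and Lemma 14.3] -/
theorem foldedIdentityAt (i : Fin 3) (L : ℕ) {β : ℝ} (hβ : 0 ≤ β) {x y : Site 3} (hx : x ∈ box 3 L) (hy : y ∈ box 3 L)
    (hx0 : x i < 0) (hy0 : y i < 0) :
    isingTwoPoint (zdGraph 3) (box 3 L) β 0 .free x (mirrorAt i y) =
      isingTwoPoint (zdGraph 3) (box 3 L) β 0 .free x y * foldHitProbAt i L β x y := by
  have hxH : x ∈ leftHalfAt i L := mem_leftHalfAt.2 ⟨hx, hx0⟩
  have hyH : y ∈ leftHalfAt i L := mem_leftHalfAt.2 ⟨hy, hy0⟩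
  have hθy : mirrorAt i y ∈ box 3 L := (mirrorAt_mem_box_iff i L y).2 hy
  have hA : ({x} : Finset (Site 3)) ∆ {mirrorAt i y} ⊆ box 3 L :=
    Finset.symmDiff_subset_union.trans (union_subset (singleton_subset_iff.2 hx) (singleton_subset_iff.2 hθy))
  have hB : ({x} : Finset (Site 3)) ∆ {y} ⊆ box 3 L :=
    Finset.symmDiff_subset_union.trans (union_subset (singleton_subset_iff.2 hx) (singleton_subset_iff.2 hy))
  rw [isingTwoPoint_eq_isingCorr_symmDiff, isingTwoPoint_eq_isingCorr_symmDiff,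
    isingCorr_free_eq_currentZ_div (Λ := box 3 L) hβ subset_rfl hA,
    isingCorr_free_eq_currentZ_div (Λ := box 3 L) hβ subset_rfl hB, currentZ_mirrorAt_eq_foldHitZAt i L hβ hxH hyH]
  unfold foldHitProbAt
  exact div_eq_div_mul_div_of_le _ ENNReal.toReal_nonneg
    (ENNReal.toReal_mono (currentZ_edgesIn_ne_top hβ subset_rfl _) (foldHitZAt_le_currentZ i L β x y))

/-! ## The transverse dictionary -/

/-- `θ₁(ke₀ − je₁) = ke₀ + je₁`. [folklore] -/
theorem mirrorAt_one_sub (k j : ℕ) :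
    mirrorAt 1 (Pi.single 0 (k : ℤ) - Pi.single 1 (j : ℤ)) = Pi.single 0 (k : ℤ) + Pi.single 1 (j : ℤ) := by
  funext i
  by_cases hi : i = 1
  · subst hi; rw [mirrorAt_apply_same]; simp
  · rw [mirrorAt_apply_ne _ _ hi]
    simp [Pi.single_eq_of_ne hi]

/-- `(ke₀ − je₁) − (−je₁) = ke₀`. [folklore] -/
theorem transverse_near_sub_far (k j : ℕ) :
    (Pi.single 0 (k : ℤ) - Pi.single 1 (j : ℤ) : Site 3) - (-Pi.single 1 (j : ℤ)) = Pi.single 0 (k : ℤ) := by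
  abel

/-- `(ke₀ + je₁) − (−je₁) = ke₀ + 2je₁`. [folklore] -/
theorem transverse_mirror_sub_far (k j : ℕ) :
    (Pi.single 0 (k : ℤ) + Pi.single 1 (j : ℤ) : Site 3) - (-Pi.single 1 (j : ℤ)) = Pi.single 0 (k : ℤ) + Pi.single 1 ((2 * j : ℕ) : ℤ) := by
  rw [sub_neg_eq_add, add_assoc, ← Pi.single_add]
  congr 2
  push_cast; ring

/-- **The transverse dictionary**: for `j ≥ 1`, the folded hitting probability of the plane `{x₁ = 0}` at `β_c` with far source `−je₁` and
near source `ke₀ − je₁` converges to `G(ke₀ + 2je₁)/g(k)` — the card's `T(k,j) = P^{0,ke₀}[ke₀ ⟷ {x₁ = j} folded]` translated by `−je₁`.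
[cite: Aizenman2025GeometricIII, Thm 14.2] -/
theorem tendsto_foldHitProbAt_transverse (k j : ℕ) (hj : 1 ≤ j) :
    Tendsto (fun L : ℕ => foldHitProbAt 1 L (criticalBeta 3) (-Pi.single 1 (j : ℤ)) (Pi.single 0 (k : ℤ) - Pi.single 1 (j : ℤ)))
      atTop (𝓝 (criticalTwoPoint 3 (Pi.single 0 (k : ℤ) + Pi.single 1 ((2 * j : ℕ) : ℤ)) /
        criticalTwoPoint 3 (Pi.single 0 (k : ℤ)))) := by
  have hβ : 0 ≤ criticalBeta 3 := criticalBeta_nonneg 3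
  have hu := tendsto_isingTwoPoint_box_sub (d := 3) hβ (-Pi.single 1 (j : ℤ)) (Pi.single 0 (k : ℤ) - Pi.single 1 (j : ℤ))
  have hv := tendsto_isingTwoPoint_box_sub (d := 3) hβ (-Pi.single 1 (j : ℤ)) (Pi.single 0 (k : ℤ) + Pi.single 1 (j : ℤ))
  have hfree : ∀ x : Site 3, twoPointFree 3 (criticalBeta 3) x = criticalTwoPoint 3 x := fun x =>
    (twoPointPlus_criticalBeta_eq_twoPointFree_holds (d := 3) le_rfl x).symm
  rw [hfree, transverse_near_sub_far] at hu
  rw [hfree, transverse_mirror_sub_far] at hv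
  have hgk : 0 < criticalTwoPoint 3 (Pi.single 0 (k : ℤ)) := Funnel.criticalTwoPoint_axis_pos 0 k
  have hupos : ∀ᶠ L : ℕ in atTop,
      0 < isingTwoPoint (zdGraph 3) (box 3 L) (criticalBeta 3) 0 .free (-Pi.single 1 (j : ℤ))
        (Pi.single 0 (k : ℤ) - Pi.single 1 (j : ℤ)) := hu.eventually (lt_mem_nhds hgk)
  refine (hv.div hu hgk.ne').congr' ?_
  filter_upwards [eventually_mem_box (d := 3) (-Pi.single 1 (j : ℤ)),
    eventually_mem_box (d := 3) (Pi.single 0 (k : ℤ) - Pi.single 1 (j : ℤ)), hupos] with L ha hb hpos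
  have hx0 : (-Pi.single 1 (j : ℤ) : Site 3) 1 < 0 := by simp; omega
  have hy0 : (Pi.single 0 (k : ℤ) - Pi.single 1 (j : ℤ) : Site 3) 1 < 0 := by simp; omega
  have hid := foldedIdentityAt 1 L hβ ha hb hx0 hy0
  rw [mirrorAt_one_sub] at hid
  show isingTwoPoint (zdGraph 3) (box 3 L) (criticalBeta 3) 0 .free (-Pi.single 1 (j : ℤ)) (Pi.single 0 (k : ℤ) + Pi.single 1 (j : ℤ)) /
      isingTwoPoint (zdGraph 3) (box 3 L) (criticalBeta 3) 0 .free (-Pi.single 1 (j : ℤ)) (Pi.single 0 (k : ℤ) - Pi.single 1 (j : ℤ)) =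
    foldHitProbAt 1 L (criticalBeta 3) (-Pi.single 1 (j : ℤ)) (Pi.single 0 (k : ℤ) - Pi.single 1 (j : ℤ))
  rw [hid]; field_simp

/-! ## Messager–Miracle-Solé: the transverse value is below the doubled axis value -/

/-- **`G(me₀ + 2ke₁) ≤ g(2k)`**: slide the point back to the `e₁` axis along `e₀` by the Messager–Miracle-Solé inequality (`m` steps,
`messager_miracleSole_holds`), then use the lattice symmetry `e₁ ↔ e₀` (`twoPointPlus_single_eq_single`). [cite: MessagerMiracleSoleJSP1977, main theorem] -/
theorem criticalTwoPoint_transverse_le (k m : ℕ) :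
    criticalTwoPoint 3 (Pi.single 0 (m : ℤ) + Pi.single 1 ((2 * k : ℕ) : ℤ)) ≤ criticalTwoPoint 3 (Pi.single 0 ((2 * k : ℕ) : ℤ)) := by
  have hβ : 0 ≤ criticalBeta 3 := criticalBeta_nonneg 3
  have hslide : ∀ m : ℕ, twoPointPlus 3 (criticalBeta 3) (Pi.single 0 (m : ℤ) + Pi.single 1 ((2 * k : ℕ) : ℤ)) ≤
      twoPointPlus 3 (criticalBeta 3) (Pi.single 1 ((2 * k : ℕ) : ℤ)) := by
    intro m
    induction m with
    | zero => simp
    | succ m ih =>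
      have hstep := messager_miracleSole_holds (d := 3) (β := criticalBeta 3) hβ
        (Pi.single 0 (m : ℤ) + Pi.single 1 ((2 * k : ℕ) : ℤ)) 0 (by simp)
      have heq : (Pi.single 0 (m : ℤ) + Pi.single 1 ((2 * k : ℕ) : ℤ) : Site 3) + Pi.single 0 1 =
          Pi.single 0 ((m + 1 : ℕ) : ℤ) + Pi.single 1 ((2 * k : ℕ) : ℤ) := by
        rw [add_right_comm, ← Pi.single_add]; push_cast; rfl
      rw [heq] at hstep
      exact hstep.trans ih
  have hsym : twoPointPlus 3 (criticalBeta 3) (Pi.single 1 ((2 * k : ℕ) : ℤ)) =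
      twoPointPlus 3 (criticalBeta 3) (Pi.single 0 ((2 * k : ℕ) : ℤ)) :=
    twoPointPlus_single_eq_single twoPointPlus_perm_invariant_holds hβ 1 0 _
  have := hslide m
  rw [hsym] at this
  simpa [criticalTwoPoint] using this

/-- **Registered sub-goal: the transverse lower bound implies item 6150.** If there is `κ > 0` such that for every `k ≥ 1`, eventually in
`L`, the folded critical cluster of the near source `ke₀ − ke₁` (far source `−ke₁`) reaches the plane `{x₁ = 0}` at transverse distance `k`
with probability `≥ κ`, then `TwoPointDoubling` holds: `κ ≤ G(ke₀ + 2ke₁)/g(k) ≤ g(2k)/g(k)`. -/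
theorem twoPointDoubling_of_transverse :
    (∃ κ : ℝ, 0 < κ ∧ ∀ k : ℕ, 1 ≤ k → ∀ᶠ L : ℕ in atTop,
        κ ≤ foldHitProbAt 1 L (criticalBeta 3) (-Pi.single 1 (k : ℤ)) (Pi.single 0 (k : ℤ) - Pi.single 1 (k : ℤ))) →
      MirrorHoelderCompactness.TwoPointDoubling := by
  rintro ⟨κ, hκ, h⟩
  refine ⟨κ, hκ, fun k hk => ?_⟩
  have hgk : 0 < criticalTwoPoint 3 (Pi.single 0 (k : ℤ)) := Funnel.criticalTwoPoint_axis_pos 0 k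
  have hle : κ ≤ criticalTwoPoint 3 (Pi.single 0 (k : ℤ) + Pi.single 1 ((2 * k : ℕ) : ℤ)) / criticalTwoPoint 3 (Pi.single 0 (k : ℤ)) :=
    ge_of_tendsto (tendsto_foldHitProbAt_transverse k k hk) (h k hk)
  rw [le_div_iff₀ hgk] at hle
  rw [Funnel.criticalTwoPoint_two_mul]
  exact hle.trans (criticalTwoPoint_transverse_le k k)

end Summit.CriticalPhenomena.Ising3DConformalLimit.Cruxes.ExistsScaleCovariantLimit.FoldedCurrentRepulsion

end
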